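import Summits.QuantumFields.BalabanUV.T4Continuum.Support.NE7WhitneyExactLiftFlat
import Summits.QuantumFields.BalabanUV.T4Continuum.Support.NE7LiftMainPartMatrix
import HarnessLib

/-!
# NE7ExactLiftGaugePart — THE EXACT LIFT OF RECORD AS A NAMED MAP `exactLift M N`, ITS GAUGE SECTOR AND ITS LETTERS: `cpush M 1 (exactLift M N w) = w`,
# **`exactLift M N (gaugeDir 1 σ) = gaugeDir 1 (interp M univ σ)`** (gauge directions are reproduced EXACTLY — the gauge corrections of the composites never compound),
# `exactLift = W∘B_c⁻¹ − gaugeDir∘interp∘Θ∘B_c⁻¹`, and the `ℓ²` letters of `gaugeDir`, `Θ`, `B_c⁻¹` (Young) — (R3d) of the composite letter (C)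
# (lineage `b2b-balaban-t4-ne7b-p1`, gen 163; route (H′), memo `t4/b2b-balaban-t4-ne7b-p1/g162/records/SCOPING-LEVELMASSES.md` §11–§12 (R3d))

Cell `pub-balaban`, rung (B)+1 sub-cell t4, lineage `b2b-balaban-t4-ne7b-p1` (row NE7b OWNER + CRUX PROVER; junction service for row NE7 on ROAD-G116 §6 (G3) ∕ the ℓ² route to (G′)),
generation 163.
WHY.  ✓ `NE7WhitneyExactLiftFlat.cpush_flatCfg_exactLift` wrote the exact one-step lift `r w = W(B_c⁻¹w − gaugeDir_1 Θ(B_c⁻¹w))` out; ✓ `NE7LiftMainPartMatrix.dirSq_TmatIter_le` bounds the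
composites of its MAIN PART `W∘B_c⁻¹` with ratio `7.2 < 8`.  The remaining GAUGE PART `−gaugeDir_1(interp(Θ B_c⁻¹ w))` is harmless in the composites because `r` maps gauge directions to
gauge directions of the nodal interpolant EXACTLY (`A := cpush_1∘W` fixes gauge directions, memo §9), on which `W` acts with its SHARP constant `L^{(d−2)∕2} = 2 < √7.2` — so the gauge
corrections of the iterate are dominated by a convergent geometric series and the ratio stays `7.2` (next file).  THIS FILE: the named map, exactness restated, subtractivity, periodicity,
the exact gauge reproduction, the decomposition main∕gauge, and the three `ℓ²` letters (`gaugeDir`: `4d`; `Θ`: `d²2^d` via ✓ `norm_sq_Fhat_whitneyLift_le`; `B_c⁻¹`: `(1∕(1−2c))^{2d} = M^{2d}`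
by Young's inequality per direction, ✓ `stencilInv1_coeff_le`).
WHAT ([folklore]; DATA defs `wlift`, `binv`, `theta`, `exactLift`; 0 sorry; every `d`, `M, N ≥ 1`; §5 at `M = 2`):
§1 the defs; **`cpush_exactLift`** (`= w` for `N`-periodic `w`); `wlift_sub`, `binv_sub`, `theta_sub`, `gaugeDir_flatCfg_sub`, **`exactLift_sub`**; periodicity `binv_periodic`, `wlift_periodic`,
   `theta_periodic`, `gaugeDir_flatCfg_periodic`, **`exactLift_periodic`** (`N`-periodic ↦ `MN`-periodic);
§2 **`exactLift_gaugeDir`**: `exactLift M N (gaugeDir 1 σ) = gaugeDir 1 (interp M univ σ)` for `N`-periodic `σ` (`binv_gaugeDir`; ✓ W1b's two push-forward theorems; ✓ `interpCore_stencilInv_datum`);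
§3 **`exactLift_eq_main_sub_gauge`**: `exactLift M N w = wlift M (binv M N w) − gaugeDir 1 (interp M univ (theta M (binv M N w)))`; at `M = 2`: `wlift_binv_two` (`= Tmat N w`);
§4 letters on periodic fields: **`dirSq_gaugeDir_flatCfg_le`** (`≤ 4d·Σ‖σ‖²`), **`sum_norm_sq_theta_le`** (`≤ d²2^d·dirSq φ`), `sum_norm_sq_stencilInv1_le` (Young, any real normed space),
   `sum_norm_sq_stencilInvList_le`, **`dirSq_binv_le`** (`≤ (1∕(1−2c))^{2d}·dirSq w`).
WHAT IS NOT HERE: the composites and (C) in root form (next file), the curved transport (R4), the hierarchical assembly (K).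
HONEST FRAMING (page 1): flat lattice kinematics + elementary inequalities about OUR lift; nothing of Bałaban's asserted ([Balaban1985Averaging] (42), (47)–(48) context only); NOT (C), NOT (G3),
NOT (G′), NOT NE7∕NE3 as spine nodes; row NE7b NOT PRINTED ∕ NOT PROVED; spine 0∕9; finite T⁴ rung (B)+1 — NOT infinite volume, NOT mass gap, NOT BetaPertH, NOT Clay.
-/

set_option autoImplicit false

open scoped BigOperators Matrix Matrix.Norms.L2Operator
open Finset

namespace Summit.QuantumFields.BalabanUV.T4Continuum.NE7ExactLiftGaugePart

open Literature.MathematicalPhysics.QuantumFieldTheory.Balaban1983to89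
open B7Prop1Explicit B7Prop2Explicit
open T4AveragingDeficitWall (dirSq)
open T4AveragingDeficitWallBoundary (periodBox mem_periodBox sum_periodBox_shift)
open AveragingDeficitMultiLevelPrep (cpush)
open B7Prop3Flat (Fhat)
open BlockAveragePushDirGauge (gaugeDir)
open MinimalActionWitness (flatCfg)
open SmoothRefineInterp (interp interpCore indic interp_sub)
open NE3CoarseInterpolant (interp_add_period)
open NE3TangentFlatPush (gaugeDir_flatCfg flatCfg_eq_flat)
open NE7WhitneyLiftFlat (dirSq_whitneyLift_le whitneyLift_gaugeDir_flat)
open NE7WhitneyLiftAverage (cpush_flatCfg_whitneyLift cpush_flatCfg_whitneyLift_gaugeDir)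
open NE7WhitneyLiftDefect (Fhat_sub' Fhat_whitneyLift_translate norm_sq_Fhat_whitneyLift_le)
open NE7WhitneyExactLiftFlat (cpush_flatCfg_exactLift interpCore_stencilInv_datum stencilInv_sub whitneyLift_sub whitney_c_nonneg whitney_c_lt_half)
open NE7InterpolationLiftCurl (sum_periodBox_sum_indic)
open NE7StencilInverse (stencilInv1 stencilInvList stencilInv stencilInv_shift stencilInv_periodic stencilInvList_cons stencilInvList_periodic stencilInv1_coeff_le)
open NE7LiftMainPartMatrix (Tmat)

noncomputable section

variable {d : ℕ} {n : Type*} [Fintype n] [DecidableEq n]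

/-! ## §1 The named lift, exactness, subtractivity, periodicity -/

/-- **THE WHITNEY-TYPE LIFT** `W φ (z,κ) = M⁻¹ • interp M (univ∖{κ}) (φ(·,κ)) z` (✓ `NE7WhitneyLiftFlat`, written out there). [folklore] -/
def wlift (M : ℕ) (φ : Site d → Fin d → Matrix n n ℂ) : Site d → Fin d → Matrix n n ℂ :=
  fun z κ' => ((M : ℝ)⁻¹) • interp M (Finset.univ.erase κ') (fun w => φ w κ') z

/-- **THE STENCIL INVERSE `B_c⁻¹`** (componentwise ✓ `stencilInv N c`, `c = (M−1)∕(2M)`). [folklore] -/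
def binv (M N : ℕ) (w : Site d → Fin d → Matrix n n ℂ) : Site d → Fin d → Matrix n n ℂ :=
  fun x κ => stencilInv N (((M : ℝ) - 1) / (2 * M)) (fun x' => w x' κ) x

/-- **THE FRAME DATUM `Θφ (y) = F̂(Wφ)(M•y)`**. [folklore] -/
def theta (M : ℕ) (φ : Site d → Fin d → Matrix n n ℂ) : Site d → Matrix n n ℂ := fun y => Fhat M (wlift M φ) ((M : ℤ) • y)

/-- **THE EXACT ONE-STEP LIFT OF RECORD** `r w = W(B_c⁻¹w − gaugeDir_1 Θ(B_c⁻¹w))` (✓ `NE7WhitneyExactLiftFlat.cpush_flatCfg_exactLift`'s argument, named). [folklore] -/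
def exactLift (M N : ℕ) (w : Site d → Fin d → Matrix n n ℂ) : Site d → Fin d → Matrix n n ℂ :=
  wlift M (fun x κ => binv M N w x κ - gaugeDir (flatCfg (d := d) (n := n)) (theta M (binv M N w)) x κ)

/-- **EXACTNESS**: `cpush M 1 (exactLift M N w) = w` for every `N`-periodic `w` (`M, N ≥ 1`). [folklore] -/
theorem cpush_exactLift {M N : ℕ} (hM : 1 ≤ M) (hN : 1 ≤ N) {w : Site d → Fin d → Matrix n n ℂ} (hw : ∀ (y : Site d) (j κ : Fin d), w (y + (N : ℤ) • e j) κ = w y κ) :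
    cpush M (flatCfg (d := d) (n := n)) (exactLift M N w) = w :=
  cpush_flatCfg_exactLift hM hN hw

omit [Fintype n] [DecidableEq n] in
/-- `W` is subtractive. [folklore] -/
theorem wlift_sub (M : ℕ) (φ ψ : Site d → Fin d → Matrix n n ℂ) : wlift M (φ - ψ) = wlift M φ - wlift M ψ := by
  funext z κ'
  simp only [wlift, Pi.sub_apply, interp_sub, smul_sub]

omit [Fintype n] [DecidableEq n] in
/-- `B_c⁻¹` is subtractive. [folklore] -/
theorem binv_sub (M N : ℕ) (u v : Site d → Fin d → Matrix n n ℂ) : binv M N (u - v) = binv M N u - binv M N v := by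
  funext x κ
  simp only [binv, Pi.sub_apply]
  exact stencilInv_sub N _ _ _ x

/-- `Θ` is subtractive. [folklore] -/
theorem theta_sub (M : ℕ) (φ ψ : Site d → Fin d → Matrix n n ℂ) : theta M (φ - ψ) = theta M φ - theta M ψ := by
  funext y
  simp only [theta, Pi.sub_apply, wlift_sub]
  exact Fhat_sub' M _ _ _

/-- The flat gauge direction is subtractive in the potential. [folklore] -/
theorem gaugeDir_flatCfg_sub (a b : Site d → Matrix n n ℂ) :
    gaugeDir (flatCfg (d := d) (n := n)) (a - b) = gaugeDir (flatCfg (d := d) (n := n)) a - gaugeDir (flatCfg (d := d) (n := n)) b := by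
  funext x μ
  simp only [gaugeDir_flatCfg, Pi.sub_apply]
  abel

/-- The flat gauge direction is additive in the potential. [folklore] -/
theorem gaugeDir_flatCfg_add (a b : Site d → Matrix n n ℂ) :
    gaugeDir (flatCfg (d := d) (n := n)) (a + b) = gaugeDir (flatCfg (d := d) (n := n)) a + gaugeDir (flatCfg (d := d) (n := n)) b := by
  funext x μ
  simp only [gaugeDir_flatCfg, Pi.add_apply]
  abel

/-- The flat gauge direction of the zero potential vanishes. [folklore] -/
theorem gaugeDir_flatCfg_zero : gaugeDir (flatCfg (d := d) (n := n)) (0 : Site d → Matrix n n ℂ) = 0 := by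
  funext x μ
  simp only [gaugeDir_flatCfg, Pi.zero_apply, sub_zero]

/-- **THE EXACT LIFT IS SUBTRACTIVE**: `exactLift M N (u − v) = exactLift M N u − exactLift M N v`. [folklore] -/
theorem exactLift_sub (M N : ℕ) (u v : Site d → Fin d → Matrix n n ℂ) : exactLift M N (u - v) = exactLift M N u - exactLift M N v := by
  unfold exactLift
  rw [← wlift_sub]
  congr 1
  funext x κ
  rw [binv_sub, theta_sub, gaugeDir_flatCfg_sub]
  simp only [Pi.sub_apply]
  abel

omit [Fintype n] [DecidableEq n] in
/-- `B_c⁻¹` preserves `N`-periodicity. [folklore] -/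
theorem binv_periodic (M N : ℕ) {w : Site d → Fin d → Matrix n n ℂ} (hw : ∀ (y : Site d) (j κ : Fin d), w (y + (N : ℤ) • e j) κ = w y κ)
    (y : Site d) (j κ : Fin d) : binv M N w (y + (N : ℤ) • e j) κ = binv M N w y κ :=
  stencilInv_periodic N _ (fun x => hw x j κ) y

omit [Fintype n] [DecidableEq n] in
/-- `W` maps `N`-periodic data to `MN`-periodic fields (`M ≥ 1`). [folklore] -/
theorem wlift_periodic {M : ℕ} (hM : 1 ≤ M) {N : ℕ} {φ : Site d → Fin d → Matrix n n ℂ} (hφ : ∀ (y : Site d) (j κ : Fin d), φ (y + (N : ℤ) • e j) κ = φ y κ)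
    (z : Site d) (j κ : Fin d) : wlift M φ (z + ((M * N : ℕ) : ℤ) • e j) κ = wlift M φ z κ := by
  simp only [wlift]
  rw [interp_add_period hM (Finset.univ.erase κ) (fun y τ => hφ y τ κ) z j]

/-- `Θ` maps `N`-periodic data to `N`-periodic frame data (`M ≥ 1`). [folklore] -/
theorem theta_periodic {M : ℕ} (hM : 1 ≤ M) {N : ℕ} {φ : Site d → Fin d → Matrix n n ℂ} (hφ : ∀ (y : Site d) (j κ : Fin d), φ (y + (N : ℤ) • e j) κ = φ y κ)
    (y : Site d) (j : Fin d) : theta M φ (y + (N : ℤ) • e j) = theta M φ y := by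
  unfold theta wlift
  rw [smul_add, Fhat_whitneyLift_translate hM]
  congr 1
  funext z κ'
  simp only [hφ]

/-- The flat gauge direction of an `N`-periodic potential is `N`-periodic. [folklore] -/
theorem gaugeDir_flatCfg_periodic {N : ℤ} {σ : Site d → Matrix n n ℂ} (hσ : ∀ (y : Site d) (j : Fin d), σ (y + N • e j) = σ y) (x : Site d) (j μ : Fin d) :
    gaugeDir (flatCfg (d := d) (n := n)) σ (x + N • e j) μ = gaugeDir (flatCfg (d := d) (n := n)) σ x μ := by
  rw [gaugeDir_flatCfg, gaugeDir_flatCfg, add_right_comm, hσ, hσ]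

/-- **THE EXACT LIFT MAPS `N`-PERIODIC DATA TO `MN`-PERIODIC FIELDS** (`M ≥ 1`). [folklore] -/
theorem exactLift_periodic {M : ℕ} (hM : 1 ≤ M) (N : ℕ) {w : Site d → Fin d → Matrix n n ℂ} (hw : ∀ (y : Site d) (j κ : Fin d), w (y + (N : ℤ) • e j) κ = w y κ)
    (z : Site d) (j κ : Fin d) : exactLift M N w (z + ((M * N : ℕ) : ℤ) • e j) κ = exactLift M N w z κ := by
  unfold exactLift
  refine wlift_periodic hM (fun y j' κ' => ?_) z j κ
  rw [binv_periodic M N hw, gaugeDir_flatCfg_periodic (fun y'' j'' => theta_periodic hM (binv_periodic M N hw) y'' j'')]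

/-! ## §2 Gauge directions are reproduced exactly -/

omit [Fintype n] [DecidableEq n] in
/-- `B_c⁻¹` of a flat gauge direction is the flat gauge direction of `b_c⁻¹` of the potential. [folklore] -/
theorem binv_gaugeDir [Fintype n] [DecidableEq n] (M N : ℕ) (σ : Site d → Matrix n n ℂ) :
    binv M N (gaugeDir (flatCfg (d := d) (n := n)) σ) = gaugeDir (flatCfg (d := d) (n := n)) (stencilInv N (((M : ℝ) - 1) / (2 * M)) σ) := by
  funext x κ
  simp only [binv, gaugeDir_flatCfg]
  rw [stencilInv_sub, stencilInv_shift]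

/-- **GAUGE DIRECTIONS ARE REPRODUCED EXACTLY** (`M, N ≥ 1`, `σ` `N`-periodic): `exactLift M N (gaugeDir 1 σ) = gaugeDir 1 (interp M univ σ)` — with `φ := B_c⁻¹(gaugeDir σ) = gaugeDir(b_c⁻¹σ)`,
W1b's two push-forward theorems give `gaugeDir(Θφ) = φ − B_c φ = φ − gaugeDir σ`, so the corrected datum is `gaugeDir σ` itself and W1a's gauge commutation finishes. [folklore] -/
theorem exactLift_gaugeDir {M N : ℕ} (hM : 1 ≤ M) (hN : 1 ≤ N) {σ : Site d → Matrix n n ℂ} (hσ : ∀ (y : Site d) (j : Fin d), σ (y + (N : ℤ) • e j) = σ y) :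
    exactLift M N (gaugeDir (flatCfg (d := d) (n := n)) σ) = gaugeDir (flatCfg (d := d) (n := n)) (interp M Finset.univ σ) := by
  set c : ℝ := ((M : ℝ) - 1) / (2 * M) with hc
  set σ' : Site d → Matrix n n ℂ := stencilInv N c σ with hσ'
  have hφ : binv M N (gaugeDir (flatCfg (d := d) (n := n)) σ) = gaugeDir (flatCfg (d := d) (n := n)) σ' := binv_gaugeDir M N σ
  -- W1b: the push-forward of the lift of a gauge direction, two ways
  have hpush : ∀ (y : Site d) (κ : Fin d),
      gaugeDir (flatCfg (d := d) (n := n)) σ' y κ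
        = (theta M (gaugeDir (flatCfg (d := d) (n := n)) σ') y - theta M (gaugeDir (flatCfg (d := d) (n := n)) σ') (y + e κ))
          + interpCore Finset.univ (fun w => gaugeDir (flatCfg (d := d) (n := n)) σ' w κ) y (fun _ => c) := by
    intro y κ
    have h1 := cpush_flatCfg_whitneyLift hM (gaugeDir (flatCfg (d := d) (n := n)) σ') y κ
    have h2 := congr_fun (congr_fun (cpush_flatCfg_whitneyLift_gaugeDir (d := d) hM σ') y) κ
    rw [h2] at h1
    unfold theta wlift
    rw [smul_add]
    exact h1
  -- `B_c φ = gaugeDir σ` (the stencil inverse undoes the binomial stencil on the periodic 1-form `gaugeDir σ`)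
  have hBc : ∀ (y : Site d) (κ : Fin d), interpCore Finset.univ (fun w => gaugeDir (flatCfg (d := d) (n := n)) σ' w κ) y (fun _ => c) = gaugeDir (flatCfg (d := d) (n := n)) σ y κ := by
    intro y κ
    have hper : ∀ (y : Site d) (j κ : Fin d), gaugeDir (flatCfg (d := d) (n := n)) σ (y + (N : ℤ) • e j) κ = gaugeDir (flatCfg (d := d) (n := n)) σ y κ :=
      fun y j κ => gaugeDir_flatCfg_periodic hσ y j κ
    have h := interpCore_stencilInv_datum (d := d) (n := n) hM hN hper y κ
    have hφ' : ∀ w, gaugeDir (flatCfg (d := d) (n := n)) σ' w κ = binv M N (gaugeDir (flatCfg (d := d) (n := n)) σ) w κ := fun w => by rw [hφ]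
    simp only [hφ']
    exact h
  -- the corrected datum is `gaugeDir σ`
  have hψ : (fun x κ => binv M N (gaugeDir (flatCfg (d := d) (n := n)) σ) x κ
      - gaugeDir (flatCfg (d := d) (n := n)) (theta M (binv M N (gaugeDir (flatCfg (d := d) (n := n)) σ))) x κ) = gaugeDir (flatCfg (d := d) (n := n)) σ := by
    funext x κ
    rw [hφ, gaugeDir_flatCfg (theta M _) x κ]
    have h := hpush x κ
    rw [hBc x κ] at h
    rw [h]
    abel
  unfold exactLift
  rw [hψ]
  funext z κ'
  simp only [wlift, flatCfg_eq_flat]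
  exact whitneyLift_gaugeDir_flat hM σ z κ'

/-! ## §3 The decomposition into main part and gauge part -/

/-- **`exactLift = W∘B_c⁻¹ − gaugeDir∘interp∘Θ∘B_c⁻¹`**. [folklore] -/
theorem exactLift_eq_main_sub_gauge {M : ℕ} (hM : 1 ≤ M) (N : ℕ) (w : Site d → Fin d → Matrix n n ℂ) :
    exactLift M N w = wlift M (binv M N w) - gaugeDir (flatCfg (d := d) (n := n)) (interp M Finset.univ (theta M (binv M N w))) := by
  unfold exactLift
  have h : (fun x κ => binv M N w x κ - gaugeDir (flatCfg (d := d) (n := n)) (theta M (binv M N w)) x κ)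
      = binv M N w - gaugeDir (flatCfg (d := d) (n := n)) (theta M (binv M N w)) := rfl
  rw [h, wlift_sub]
  congr 1
  funext z κ'
  simp only [wlift, flatCfg_eq_flat]
  exact whitneyLift_gaugeDir_flat hM _ z κ'

omit [Fintype n] [DecidableEq n] in
/-- At `M = 2` the main part is ✓ `Tmat`: `wlift 2 (binv 2 N w) = Tmat N w` (`c = ¼`). [folklore] -/
theorem wlift_binv_two (N : ℕ) (w : Site d → Fin d → Matrix n n ℂ) (z : Site d) (κ : Fin d) :
    wlift 2 (binv 2 N w) z κ = ((2 : ℝ)⁻¹) • interp 2 (Finset.univ.erase κ) (stencilInv N (1 / 4 : ℝ) (fun x => w x κ)) z := by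
  have hc : ((2 : ℝ) - 1) / (2 * 2) = 1 / 4 := by norm_num
  simp only [wlift, binv, Nat.cast_ofNat, hc]

/-! ## §4 The `ℓ²` letters of the gauge part on periodic fields -/

/-- **THE GAUGE-DIRECTION LETTER**: `dirSq (gaugeDir 1 σ) [0,P)^d ≤ 4d·Σ_{[0,P)^d} ‖σ‖²` for `P`-periodic `σ` (`P ≥ 1`). [folklore] -/
theorem dirSq_gaugeDir_flatCfg_le {P : ℕ} (hP : 1 ≤ P) {σ : Site d → Matrix n n ℂ} (hσ : ∀ (y : Site d) (j : Fin d), σ (y + (P : ℤ) • e j) = σ y) :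
    dirSq (gaugeDir (flatCfg (d := d) (n := n)) σ) (periodBox (d := d) P) ≤ 4 * d * ∑ y ∈ periodBox (d := d) P, ‖σ y‖ ^ 2 := by
  unfold dirSq
  have hpt : ∀ (x : Site d) (μ : Fin d), ‖gaugeDir (flatCfg (d := d) (n := n)) σ x μ‖ ^ 2 ≤ 2 * ‖σ x‖ ^ 2 + 2 * ‖σ (x + e μ)‖ ^ 2 := by
    intro x μ
    rw [gaugeDir_flatCfg]
    have h := norm_sub_le (σ x) (σ (x + e μ))
    have h2 : ‖σ x - σ (x + e μ)‖ ^ 2 ≤ (‖σ x‖ + ‖σ (x + e μ)‖) ^ 2 := pow_le_pow_left₀ (norm_nonneg _) h 2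
    nlinarith [h2, sq_nonneg (‖σ x‖ - ‖σ (x + e μ)‖)]
  have hshift : ∀ μ : Fin d, ∑ x ∈ periodBox (d := d) P, ‖σ (x + e μ)‖ ^ 2 = ∑ x ∈ periodBox (d := d) P, ‖σ x‖ ^ 2 :=
    fun μ => sum_periodBox_shift P hP (g := fun x => ‖σ x‖ ^ 2) (fun x j => by simp only [hσ]) (e μ)
  calc ∑ x ∈ periodBox (d := d) P, ∑ μ : Fin d, ‖gaugeDir (flatCfg (d := d) (n := n)) σ x μ‖ ^ 2
      ≤ ∑ x ∈ periodBox (d := d) P, ∑ μ : Fin d, (2 * ‖σ x‖ ^ 2 + 2 * ‖σ (x + e μ)‖ ^ 2) := Finset.sum_le_sum fun x _ => Finset.sum_le_sum fun μ _ => hpt x μ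
    _ = ∑ μ : Fin d, (2 * ∑ x ∈ periodBox (d := d) P, ‖σ x‖ ^ 2 + 2 * ∑ x ∈ periodBox (d := d) P, ‖σ (x + e μ)‖ ^ 2) := by
        rw [Finset.sum_comm]; simp only [Finset.sum_add_distrib, Finset.mul_sum]
    _ = 4 * d * ∑ y ∈ periodBox (d := d) P, ‖σ y‖ ^ 2 := by
        simp only [hshift, Finset.sum_const, Finset.card_univ, Fintype.card_fin, nsmul_eq_mul]; ring

/-- **THE FRAME-DATUM LETTER**: `Σ_{y∈[0,N)^d} ‖Θφ(y)‖² ≤ d²·2^d·dirSq φ [0,N)^d` for `N`-periodic `φ` (`M, N ≥ 1`; ✓ `norm_sq_Fhat_whitneyLift_le` + corner shifts). [folklore] -/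
theorem sum_norm_sq_theta_le {M N : ℕ} (hM : 1 ≤ M) (hN : 1 ≤ N) {φ : Site d → Fin d → Matrix n n ℂ} (hφ : ∀ (y : Site d) (j κ : Fin d), φ (y + (N : ℤ) • e j) κ = φ y κ) :
    ∑ y ∈ periodBox (d := d) N, ‖theta M φ y‖ ^ 2 ≤ (d : ℝ) ^ 2 * 2 ^ d * dirSq φ (periodBox (d := d) N) := by
  have hpt : ∀ y : Site d, ‖theta M φ y‖ ^ 2 ≤ (d : ℝ) ^ 2 * ∑ j : Fin d, ∑ T ∈ (Finset.univ : Finset (Fin d)).powerset, ‖φ (y + indic T) j‖ ^ 2 :=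
    fun y => norm_sq_Fhat_whitneyLift_le hM φ y
  have hg : ∀ (x : Site d) (κ : Fin d), (∑ j : Fin d, ‖φ (x + (N : ℤ) • e κ) j‖ ^ 2) = ∑ j : Fin d, ‖φ x j‖ ^ 2 := by
    intro x κ; simp only [hφ]
  have hcorner := sum_periodBox_sum_indic (d := d) (g := fun z => ∑ j : Fin d, ‖φ z j‖ ^ 2) hN hg
  calc ∑ y ∈ periodBox (d := d) N, ‖theta M φ y‖ ^ 2
      ≤ ∑ y ∈ periodBox (d := d) N, (d : ℝ) ^ 2 * ∑ j : Fin d, ∑ T ∈ (Finset.univ : Finset (Fin d)).powerset, ‖φ (y + indic T) j‖ ^ 2 := Finset.sum_le_sum fun y _ => hpt y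
    _ = (d : ℝ) ^ 2 * ∑ y ∈ periodBox (d := d) N, ∑ T ∈ (Finset.univ : Finset (Fin d)).powerset, ∑ j : Fin d, ‖φ (y + indic T) j‖ ^ 2 := by
        rw [← Finset.mul_sum]
        congr 1
        exact Finset.sum_congr rfl fun y _ => Finset.sum_comm
    _ = (d : ℝ) ^ 2 * (2 ^ d * ∑ y ∈ periodBox (d := d) N, ∑ j : Fin d, ‖φ y j‖ ^ 2) := by rw [hcorner]
    _ = (d : ℝ) ^ 2 * 2 ^ d * dirSq φ (periodBox (d := d) N) := by unfold dirSq; ring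

section Young

variable {X : Type*} [NormedAddCommGroup X] [NormedSpace ℝ X]

/-- **YOUNG'S INEQUALITY FOR THE ONE-DIRECTION STENCIL INVERSE** on `N`-periodic fields with values in any real normed space (`0 ≤ c < ½`, `N ≥ 1`):
`Σ_{y∈[0,N)^d} ‖stencilInv1 i N (1−c) c G y‖² ≤ (1∕(1−2c))²·Σ_{y∈[0,N)^d} ‖G y‖²`. [folklore] -/
theorem sum_norm_sq_stencilInv1_le (i : Fin d) {N : ℕ} (hN : 1 ≤ N) {c : ℝ} (hc0 : 0 ≤ c) (hc : c < 1 / 2) {G : Site d → X}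
    (hG : ∀ (y : Site d) (j : Fin d), G (y + (N : ℤ) • e j) = G y) :
    ∑ y ∈ periodBox (d := d) N, ‖stencilInv1 i N (1 - c) c G y‖ ^ 2 ≤ (1 / (1 - 2 * c)) ^ 2 * ∑ y ∈ periodBox (d := d) N, ‖G y‖ ^ 2 := by
  set K : ℝ := ((1 - c) * (1 - (-c / (1 - c)) ^ N))⁻¹ with hK
  set q : ℝ := -c / (1 - c) with hq
  set A : ℝ := |K| * ∑ k ∈ range N, |q| ^ k with hA
  have hA0 : 0 ≤ A := mul_nonneg (abs_nonneg _) (Finset.sum_nonneg fun _ _ => pow_nonneg (abs_nonneg _) _)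
  have hAle : A ≤ 1 / (1 - 2 * c) := stencilInv1_coeff_le hc0 hc hN
  have hE0 : 0 ≤ ∑ y ∈ periodBox (d := d) N, ‖G y‖ ^ 2 := Finset.sum_nonneg fun _ _ => sq_nonneg _
  -- pointwise: triangle inequality and weighted Cauchy–Schwarz
  have hpt : ∀ y : Site d, ‖stencilInv1 i N (1 - c) c G y‖ ^ 2 ≤ A * ∑ k ∈ range N, |K| * |q| ^ k * ‖G (y + ((k : ℕ) : ℤ) • e i)‖ ^ 2 := by
    intro y
    have h1 : ‖stencilInv1 i N (1 - c) c G y‖ ≤ ∑ k ∈ range N, |K| * |q| ^ k * ‖G (y + ((k : ℕ) : ℤ) • e i)‖ := by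
      show ‖K • ∑ k ∈ range N, (q ^ k) • G (y + ((k : ℕ) : ℤ) • e i)‖ ≤ _
      rw [norm_smul, Real.norm_eq_abs]
      calc |K| * ‖∑ k ∈ range N, (q ^ k) • G (y + ((k : ℕ) : ℤ) • e i)‖
          ≤ |K| * ∑ k ∈ range N, ‖(q ^ k) • G (y + ((k : ℕ) : ℤ) • e i)‖ := mul_le_mul_of_nonneg_left (norm_sum_le _ _) (abs_nonneg _)
        _ = ∑ k ∈ range N, |K| * |q| ^ k * ‖G (y + ((k : ℕ) : ℤ) • e i)‖ := by
            rw [Finset.mul_sum]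
            refine Finset.sum_congr rfl fun k _ => ?_
            rw [norm_smul, Real.norm_eq_abs, abs_pow]; ring
    have h2 : (∑ k ∈ range N, |K| * |q| ^ k * ‖G (y + ((k : ℕ) : ℤ) • e i)‖) ^ 2
        ≤ (∑ k ∈ range N, |K| * |q| ^ k) * ∑ k ∈ range N, |K| * |q| ^ k * ‖G (y + ((k : ℕ) : ℤ) • e i)‖ ^ 2 :=
      sum_sq_le_sum_mul_sum_of_sq_le_mul _ (fun k _ => by positivity) (fun k _ => by positivity) (fun k _ => by rw [mul_pow]; ring_nf; rfl)
    calc ‖stencilInv1 i N (1 - c) c G y‖ ^ 2 ≤ (∑ k ∈ range N, |K| * |q| ^ k * ‖G (y + ((k : ℕ) : ℤ) • e i)‖) ^ 2 := pow_le_pow_left₀ (norm_nonneg _) h1 2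
      _ ≤ (∑ k ∈ range N, |K| * |q| ^ k) * ∑ k ∈ range N, |K| * |q| ^ k * ‖G (y + ((k : ℕ) : ℤ) • e i)‖ ^ 2 := h2
      _ = A * ∑ k ∈ range N, |K| * |q| ^ k * ‖G (y + ((k : ℕ) : ℤ) • e i)‖ ^ 2 := by rw [hA, ← Finset.mul_sum]
  have hshift : ∀ k : ℕ, ∑ y ∈ periodBox (d := d) N, ‖G (y + ((k : ℕ) : ℤ) • e i)‖ ^ 2 = ∑ y ∈ periodBox (d := d) N, ‖G y‖ ^ 2 :=
    fun k => sum_periodBox_shift N hN (g := fun x => ‖G x‖ ^ 2) (fun x j => by simp only [hG]) _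
  calc ∑ y ∈ periodBox (d := d) N, ‖stencilInv1 i N (1 - c) c G y‖ ^ 2
      ≤ ∑ y ∈ periodBox (d := d) N, A * ∑ k ∈ range N, |K| * |q| ^ k * ‖G (y + ((k : ℕ) : ℤ) • e i)‖ ^ 2 := Finset.sum_le_sum fun y _ => hpt y
    _ = A * ∑ k ∈ range N, |K| * |q| ^ k * ∑ y ∈ periodBox (d := d) N, ‖G (y + ((k : ℕ) : ℤ) • e i)‖ ^ 2 := by
        rw [← Finset.mul_sum, Finset.sum_comm]; simp only [Finset.mul_sum]
    _ = A * A * ∑ y ∈ periodBox (d := d) N, ‖G y‖ ^ 2 := by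
        simp only [hshift]
        rw [← Finset.sum_mul, hA, Finset.mul_sum]
        ring
    _ ≤ (1 / (1 - 2 * c)) ^ 2 * ∑ y ∈ periodBox (d := d) N, ‖G y‖ ^ 2 := by
        rw [sq]
        exact mul_le_mul_of_nonneg_right (mul_le_mul hAle hAle hA0 (hA0.trans hAle)) hE0

/-- Young for the iterated stencil inverse over a list of directions. [folklore] -/
theorem sum_norm_sq_stencilInvList_le {N : ℕ} (hN : 1 ≤ N) {c : ℝ} (hc0 : 0 ≤ c) (hc : c < 1 / 2) :
    ∀ (l : List (Fin d)) {G : Site d → X}, (∀ (y : Site d) (j : Fin d), G (y + (N : ℤ) • e j) = G y) →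
      ∑ y ∈ periodBox (d := d) N, ‖stencilInvList l N (1 - c) c G y‖ ^ 2 ≤ ((1 / (1 - 2 * c)) ^ 2) ^ l.length * ∑ y ∈ periodBox (d := d) N, ‖G y‖ ^ 2 := by
  intro l
  induction l with
  | nil => intro G _; simp
  | cons i l ih =>
      intro G hG
      have hH : ∀ (y : Site d) (j : Fin d), stencilInvList l N (1 - c) c G (y + (N : ℤ) • e j) = stencilInvList l N (1 - c) c G y :=
        fun y j => stencilInvList_periodic l N (1 - c) c (fun x => hG x j) y
      simp only [stencilInvList_cons, List.length_cons, pow_succ]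
      calc ∑ y ∈ periodBox (d := d) N, ‖stencilInv1 i N (1 - c) c (stencilInvList l N (1 - c) c G) y‖ ^ 2
          ≤ (1 / (1 - 2 * c)) ^ 2 * ∑ y ∈ periodBox (d := d) N, ‖stencilInvList l N (1 - c) c G y‖ ^ 2 := sum_norm_sq_stencilInv1_le i hN hc0 hc hH
        _ ≤ (1 / (1 - 2 * c)) ^ 2 * (((1 / (1 - 2 * c)) ^ 2) ^ l.length * ∑ y ∈ periodBox (d := d) N, ‖G y‖ ^ 2) := mul_le_mul_of_nonneg_left (ih hG) (sq_nonneg _)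
        _ = ((1 / (1 - 2 * c)) ^ 2) ^ l.length * (1 / (1 - 2 * c)) ^ 2 * ∑ y ∈ periodBox (d := d) N, ‖G y‖ ^ 2 := by ring

/-- Young for `stencilInv`: `Σ‖stencilInv N c G‖² ≤ (1∕(1−2c))^{2d}·Σ‖G‖²`. [folklore] -/
theorem sum_norm_sq_stencilInv_le {N : ℕ} (hN : 1 ≤ N) {c : ℝ} (hc0 : 0 ≤ c) (hc : c < 1 / 2) {G : Site d → X}
    (hG : ∀ (y : Site d) (j : Fin d), G (y + (N : ℤ) • e j) = G y) :
    ∑ y ∈ periodBox (d := d) N, ‖stencilInv N c G y‖ ^ 2 ≤ ((1 / (1 - 2 * c)) ^ 2) ^ d * ∑ y ∈ periodBox (d := d) N, ‖G y‖ ^ 2 := by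
  have h := sum_norm_sq_stencilInvList_le (d := d) hN hc0 hc (List.finRange d) hG
  rw [List.length_finRange] at h
  exact h

end Young

/-- **THE STENCIL-INVERSE LETTER**: `dirSq (B_c⁻¹ w) [0,N)^d ≤ (1∕(1−2c))^{2d}·dirSq w [0,N)^d` for `N`-periodic `w` (`M, N ≥ 1`, `c = (M−1)∕(2M)`, `1∕(1−2c) = M`). [folklore] -/
theorem dirSq_binv_le {M N : ℕ} (hM : 1 ≤ M) (hN : 1 ≤ N) {w : Site d → Fin d → Matrix n n ℂ} (hw : ∀ (y : Site d) (j κ : Fin d), w (y + (N : ℤ) • e j) κ = w y κ) :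
    dirSq (binv M N w) (periodBox (d := d) N) ≤ ((1 / (1 - 2 * (((M : ℝ) - 1) / (2 * M)))) ^ 2) ^ d * dirSq w (periodBox (d := d) N) := by
  unfold dirSq
  calc ∑ x ∈ periodBox (d := d) N, ∑ κ : Fin d, ‖binv M N w x κ‖ ^ 2
      = ∑ κ : Fin d, ∑ x ∈ periodBox (d := d) N, ‖stencilInv N (((M : ℝ) - 1) / (2 * M)) (fun x' => w x' κ) x‖ ^ 2 := by rw [Finset.sum_comm]; rfl
    _ ≤ ∑ κ : Fin d, ((1 / (1 - 2 * (((M : ℝ) - 1) / (2 * M)))) ^ 2) ^ d * ∑ x ∈ periodBox (d := d) N, ‖w x κ‖ ^ 2 :=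
        Finset.sum_le_sum fun κ _ => sum_norm_sq_stencilInv_le hN (whitney_c_nonneg hM) (whitney_c_lt_half hM) (G := fun x => w x κ) (fun y j => hw y j κ)
    _ = ((1 / (1 - 2 * (((M : ℝ) - 1) / (2 * M)))) ^ 2) ^ d * ∑ x ∈ periodBox (d := d) N, ∑ κ : Fin d, ‖w x κ‖ ^ 2 := by
        rw [← Finset.mul_sum, Finset.sum_comm]

/-- `1∕(1 − 2c) = M` at `c = (M−1)∕(2M)` (`M ≥ 1`). [folklore] -/
theorem inv_one_sub_two_c {M : ℕ} (hM : 1 ≤ M) : 1 / (1 - 2 * (((M : ℝ) - 1) / (2 * M))) = M := by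
  have hM0 : (M : ℝ) ≠ 0 := by exact_mod_cast (by omega : M ≠ 0)
  field_simp
  ring

end

end Summit.QuantumFields.BalabanUV.T4Continuum.NE7ExactLiftGaugePart
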